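import Literature.NumberTheory.EllipticCurves.Kato2004.IwasawaCohomologyCoeffExistsProofs
import HarnessLib

/-!
# Kato 2004 (Astérisque 295) §12.2 / §13.8 with coefficients: the pinned Iwasawa cohomology
# `𝐇¹_Γ(T)` over `A⟦X⟧` is RIGID — the `A⟦X⟧`-action at each level is forced, any two pins are
# canonically isomorphic, and Thm. 12.4 (2) for `𝒪_λ`-lattices needs ONE datum only (proofs only)

Topic `NumberTheory/EllipticCurves`, sub-directory `Kato2004` (namespace = path).  THEOREMS ONLY (no
definition, no named fact, no `instance`, no `sorry`).  Sibling proof file of the pin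
`Kato2004/IwasawaCohomologyCoeff.lean` (`IwasawaH1DataCoeff T p κ γ`: an abstract `A⟦X⟧`-module `H` with
projections `proj n : H → H¹(ℚ_n, T)` subject to `proj_mem`, `cores_proj`, `proj_injective`,
`proj_surjective`, `proj_T_smul`, `proj_C_smul`), of its existence proof
`Kato2004/IwasawaCohomologyCoeffExistsProofs.lean` (K0a, whose Weierstrass-division lemma
`IwasawaH1CoeffExists.exists_polynomial_sub_coe_mem_span` is reused) and of the named fact
`Kato2004.thm12_4_newform` (K0b, `Kato2004/IwasawaCohomologyCoeffNewform.lean`; print leaf of route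
`ResidualThetaTransportAtTwo`, item stmt-BirchSwinnertonDyer-24115).  Seat `bsd-wall-tp2-p2x-w2` g23; it
types the remark "the datum is RIGID" of the K0b sizing memo of seat `bsd-wall-tp2-p2x` g20.

* §1 `proj_coe_polynomial_smul` — on ANY pin, a polynomial `r ∈ A[X]` acts on the `n`-th layer as
  `r(θ_n − 1)`, `θ_n = conj_γ` (iterate `proj_T_smul`, `proj_C_smul`); `proj_omega_smul` —
  `ω_n = (X+1)^{p^n} − 1` kills the `n`-th layer (`θ_n^{p^n} = 1`: `γ^{p^n} ∈ Gal(ℚ̄/ℚ_n)` acts trivially,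
  `conjMap_toLinearMap_pow_eq_one`); `proj_smul_eq_aeval_of_sub_mem` — hence for EVERY power series `f`
  and polynomial `r ≡ f (mod ω_n)`: `proj n (f • x) = r(θ_n − 1)(proj n x)`.  So the level-`n` component
  of `f • x` depends only on `proj n x` (`proj_smul_eq_of_proj_eq`, over an `I`-adically complete `A`
  with `p ∈ I`, where such `r` exists by Weierstrass division).
* §2 **`exists_linearEquiv_proj_eq`** — RIGIDITY: for `A` nontrivial and `I`-adically complete, `p ∈ I`,
  `γ` a topological generator, any two pins `J₁ J₂ : IwasawaH1DataCoeff T p κ γ` are isomorphic as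
  `A⟦X⟧`-modules by an isomorphism commuting with all `proj n` (the composite of the two bijections onto
  the norm-compatible integral families is additive and, by §1, `A⟦X⟧`-linear); consequently
  `Module.Finite`, `Module.IsTorsionFree` and `Module.rank` over `A⟦X⟧` agree for all pins
  (`module_finite_iff`, `isTorsionFree_iff`, `rank_eq`).
* §3 `thm12_4_clauses_of_exists` / **`thm12_4_newform_of_exists`** — for `𝒪 = padicCoeffIntegers S`
  (`ℚ_p(S)/ℚ_p` finite; a complete DVR with `p ∈ 𝔪`): the three clauses of Kato's Thm. 12.4 (2) /
  (12.2.1) hold for EVERY pin of `𝐇¹_Γ(T_ρ)` as soon as they hold for ONE; hence the named fact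
  `thm12_4_newform` (stated "for every datum `I`") follows from its `∃ I`-form — K0b is a statement
  about one module, e.g. the norm-compatible families of K0a's construction.

HONEST FRAMING: module algebra on the pin plus Weierstrass division; no arithmetic input, nothing of
Thm. 12.4 itself is proved here (`thm12_4_newform` stays a named fact); BSD is not advanced by this file.
Printed source of the structure being rigidified: Kato §12.2 [p. 220] ("`𝐇^q(T) = lim← H^q(ℤ[ζ_{p^n},
1/p], T)` … with respect to trace maps", a `ℤ_p[[G_∞]]`-module) and §13.8 [p. 228] (the `Λ`-structure
"through the second factor" of `T ⊗ O_λ[G_n]`, i.e. `O_λ[G_n] = O_λ[X]/(ω_n)` at level `n` — exactly §1).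

## References

* [Kato2004Asterisque] K. Kato, *p-adic Hodge theory and values of zeta functions of modular forms*,
  Astérisque 295 (2004): §12.2 (12.2.1) (p. 220), Thm. 12.4 (2) (p. 221), §13.8 (p. 228).
* [Lang1990] S. Lang, *Cyclotomic Fields I and II*, GTM 121 (1990), Ch. 5 §1 Thm. 1.1
  (`Λ ≅ lim← O[X]/(ω_n)`).
* [Washington1997] L. C. Washington, *Introduction to Cyclotomic Fields* (1997), Thm. 7.1, Prop. 7.2.
-/

noncomputable section

open scoped NumberField
open Field CategoryTheory Polynomial
open Literature.NumberTheory.GaloisRepresentations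
open Literature.NumberTheory.EllipticCurves Literature.NumberTheory.EllipticCurves.Kato2004
open Literature.NumberTheory.EllipticCurves.Kato2004.EulerSystemValues

namespace Literature.NumberTheory.EllipticCurves.Kato2004

namespace IwasawaH1DataCoeff

section LevelAction

variable {A : Type} [CommRing A] [TopologicalSpace A] {M : Type} [AddCommGroup M] [Module A M]
  [TopologicalSpace M] [IsTopologicalAddGroup M] [ContinuousSMul A M]
  {T : GaloisRep ℚ A M} {p : ℕ} [Fact p.Prime] {κ : ZpExtension ℚ p} {γ : absoluteGaloisGroup ℚ}
  (J : IwasawaH1DataCoeff T p κ γ)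

/-- **A polynomial `r ∈ A[X] ⊂ A⟦X⟧` acts on the `n`-th layer of ANY pin as `r(θ_n − 1)`, `θ_n = conj_γ`:**
`proj n (r • x) = (aeval (θ_n − 1) r) (proj n x)` (from `proj_C_smul` and `proj_T_smul` / `proj_X_pow_smul`
by induction on `r`).  Kato §13.8: at level `n` the `O_λ[[G_∞]]`-structure is that of `O_λ[G_n] ∋ γ ↦ θ_n`.
[cite: Kato2004Asterisque, §13.8 (p. 228) and §12.2 (p. 220)] -/
theorem proj_coe_polynomial_smul (r : A[X]) (n : ℕ) (x : J.H) :
    J.proj n ((r : PowerSeries A) • x) =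
      aeval ((conjMap T.toTopRep (κ.layerSubgroup n) γ 1).hom.toLinearMap - 1) r (J.proj n x) := by
  induction r using Polynomial.induction_on' generalizing x with
  | add r s hr hs =>
    rw [Polynomial.coe_add, add_smul, map_add, hr, hs, map_add, LinearMap.add_apply]
  | monomial k c =>
    rw [← Polynomial.C_mul_X_pow_eq_monomial, Polynomial.coe_mul, Polynomial.coe_C, Polynomial.coe_pow,
      Polynomial.coe_X, J.proj_C_mul_smul, J.proj_X_pow_smul, map_mul, Polynomial.aeval_C, map_pow,
      Polynomial.aeval_X, Module.End.mul_apply, Module.algebraMap_end_apply]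
    congr 1
    induction k generalizing x with
    | zero => simp
    | succ k ih =>
      rw [Function.iterate_succ_apply', ih, pow_succ', Module.End.mul_apply, LinearMap.sub_apply,
        Module.End.one_apply]
      rfl

/-- `γ^{pⁿ} ∈ Gal(ℚ̄/ℚ_n)` (local copy). [folklore] -/
private theorem pow_mem_layerSubgroup' (hγ : κ.IsTopGenerator γ) (n : ℕ) :
    γ ^ p ^ n ∈ κ.layerSubgroup n := by
  have hγ' : κ γ = Multiplicative.ofAdd 1 := hγ
  rw [ZpExtension.mem_layerSubgroup, map_pow, hγ', ← ofAdd_nsmul, toAdd_ofAdd, nsmul_eq_mul,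
    mul_one, Nat.cast_pow]

/-- **`ω_n = (X+1)^{p^n} − 1` kills the `n`-th layer of any pin** (`γ` a topological generator):
`proj n (ω_n • x) = (θ_n^{p^n} − 1)(proj n x) = 0`, since `γ^{p^n} ∈ Gal(ℚ̄/ℚ_n)` acts trivially on
`H¹(ℚ_n, T)` (`conjMap_toLinearMap_pow_eq_one`).  Lang Ch. 5 §1 / Washington Thm. 7.1: the `n`-th term of
`Λ ≅ lim← O[X]/(ω_n)`. [cite: Lang1990, Ch. 5 §1 Thm. 1.1] [cite: Kato2004Asterisque, §13.8 (p. 228)] -/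
theorem proj_omega_smul (hγ : κ.IsTopGenerator γ) (n : ℕ) (x : J.H) :
    J.proj n ((((X + 1 : A[X]) ^ p ^ n - 1 : A[X]) : PowerSeries A) • x) = 0 := by
  rw [J.proj_coe_polynomial_smul]
  have hθ : (conjMap T.toTopRep (κ.layerSubgroup n) γ 1).hom.toLinearMap ^ p ^ n = 1 :=
    conjMap_toLinearMap_pow_eq_one T.toTopRep (κ.layerSubgroup n) (pow_mem_layerSubgroup' hγ n)
  simp [map_sub, map_pow, map_add, aeval_X, sub_add_cancel, hθ]

/-- **The level-`n` component of `f • x` for a POWER SERIES `f`:** if `r ∈ A[X]` is congruent to `f`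
modulo `ω_n` in `A⟦X⟧` then `proj n (f • x) = (aeval (θ_n − 1) r) (proj n x)` on any pin (write
`f = r + s ω_n` and use `proj_coe_polynomial_smul`, `proj_omega_smul`).  Over an `I`-adically complete `A`
with `p ∈ I` such an `r` always exists (Weierstrass division, Washington Prop. 7.2,
`IwasawaH1CoeffExists.exists_polynomial_sub_coe_mem_span`). [cite: Washington1997, Thm. 7.1 and Prop. 7.2]
[cite: Kato2004Asterisque, §13.8 (p. 228)] -/
theorem proj_smul_eq_aeval_of_sub_mem (hγ : κ.IsTopGenerator γ) {f : PowerSeries A} {r : A[X]} {n : ℕ}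
    (h : f - (r : PowerSeries A) ∈
      Ideal.span {(((X + 1 : A[X]) ^ p ^ n - 1 : A[X]) : PowerSeries A)}) (x : J.H) :
    J.proj n (f • x) =
      aeval ((conjMap T.toTopRep (κ.layerSubgroup n) γ 1).hom.toLinearMap - 1) r (J.proj n x) := by
  obtain ⟨s, hs⟩ := Ideal.mem_span_singleton'.mp h
  have hf : f = (r : PowerSeries A) + s * (((X + 1 : A[X]) ^ p ^ n - 1 : A[X]) : PowerSeries A) := by
    rw [hs]; ring
  rw [hf, add_smul, map_add, J.proj_coe_polynomial_smul, mul_comm s, mul_smul, J.proj_omega_smul hγ,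
    add_zero]

end LevelAction

/-! ## §2 Rigidity: any two pins are canonically isomorphic `A⟦X⟧`-modules -/

section Rigidity

variable {A : Type} [CommRing A] [TopologicalSpace A] {M : Type} [AddCommGroup M] [Module A M]
  [TopologicalSpace M] [IsTopologicalAddGroup M] [ContinuousSMul A M]
  {T : GaloisRep ℚ A M} {p : ℕ} [Fact p.Prime] {κ : ZpExtension ℚ p} {γ : absoluteGaloisGroup ℚ}
  [Nontrivial A] {I : Ideal A} [IsAdicComplete I A]

/-- **The `A⟦X⟧`-action of a pin is FORCED levelwise:** over a nontrivial `I`-adically complete `A` with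
`p ∈ I` and for `γ` a topological generator, the `n`-th component of `f • x` depends only on the `n`-th
component of `x` — for two pins `J₁, J₂` (possibly equal) and `x_i ∈ J_i.H` with the same `proj n`, the
elements `f • x_i` have the same `proj n` (`proj_smul_eq_aeval_of_sub_mem` with a Weierstrass remainder
`r ≡ f (mod ω_n)`). [cite: Kato2004Asterisque, §13.8 (p. 228)] [cite: Washington1997, Prop. 7.2] -/
theorem proj_smul_eq_of_proj_eq (hp : (p : A) ∈ I) (hγ : κ.IsTopGenerator γ)
    (J₁ J₂ : IwasawaH1DataCoeff T p κ γ) (f : PowerSeries A) {n : ℕ} {x₁ : J₁.H} {x₂ : J₂.H}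
    (h : J₁.proj n x₁ = J₂.proj n x₂) : J₁.proj n (f • x₁) = J₂.proj n (f • x₂) := by
  obtain ⟨r, hr⟩ := IwasawaH1CoeffExists.exists_polynomial_sub_coe_mem_span p hp n f
  rw [J₁.proj_smul_eq_aeval_of_sub_mem hγ hr, J₂.proj_smul_eq_aeval_of_sub_mem hγ hr, h]

/-- **RIGIDITY of the pinned Iwasawa cohomology.**  Over a nontrivial `I`-adically complete coefficient
ring `A` with `p ∈ I`, for `γ` a topological generator of the `ℤ_p`-extension `κ`: any two data
`J₁ J₂ : IwasawaH1DataCoeff T p κ γ` are isomorphic `A⟦X⟧`-modules by an isomorphism `e` with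
`proj n (e x) = proj n x` for all `n` — both biject onto the norm-compatible integral families
(`proj_injective`, `proj_surjective`), the composite bijection is additive, and it is `A⟦X⟧`-linear
because the level-`n` component of `f • x` is determined by that of `x` (`proj_smul_eq_of_proj_eq`).  So
Kato's `𝐇¹(T) = lim←_n H¹(ℤ[ζ_{p^n}, 1/p], T)` with its `Λ`-structure (§12.2, §13.8) is pinned up to UNIQUE
isomorphism by the interface. [cite: Kato2004Asterisque, §12.2 (p. 220) and §13.8 (p. 228)] -/
theorem exists_linearEquiv_proj_eq (hp : (p : A) ∈ I) (hγ : κ.IsTopGenerator γ)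
    (J₁ J₂ : IwasawaH1DataCoeff T p κ γ) :
    ∃ e : J₁.H ≃ₗ[PowerSeries A] J₂.H, ∀ n x, J₂.proj n (e x) = J₁.proj n x := by
  -- the comparison maps: the unique lifts of the families of projections
  let Φ : J₁.H → J₂.H := fun x ↦ J₂.lift (J₁.isNormCompatible_toFamily x)
  have hΦ : ∀ n x, J₂.proj n (Φ x) = J₁.proj n x := fun n x ↦ J₂.proj_lift _ n
  let Ψ : J₂.H → J₁.H := fun y ↦ J₁.lift (J₂.isNormCompatible_toFamily y)
  have hΨ : ∀ n y, J₁.proj n (Ψ y) = J₂.proj n y := fun n y ↦ J₁.proj_lift _ n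
  refine ⟨{ toFun := Φ
            map_add' := fun x y ↦ J₂.eq_iff_forall_proj_eq.mpr fun n ↦ by
              rw [hΦ, map_add, map_add, hΦ, hΦ]
            map_smul' := fun f x ↦ J₂.eq_iff_forall_proj_eq.mpr fun n ↦ by
              rw [RingHom.id_apply, hΦ]
              exact proj_smul_eq_of_proj_eq hp hγ J₁ J₂ f (hΦ n x).symm
            invFun := Ψ
            left_inv := fun x ↦ J₁.eq_iff_forall_proj_eq.mpr fun n ↦ by rw [hΨ, hΦ]
            right_inv := fun y ↦ J₂.eq_iff_forall_proj_eq.mpr fun n ↦ by rw [hΦ, hΨ] }, hΦ⟩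

/-- Finite generation over `A⟦X⟧` ((12.2.1)) holds for one pin iff for any other (rigidity).
[cite: Kato2004Asterisque, §12.2 (12.2.1) (p. 220)] -/
theorem module_finite_iff (hp : (p : A) ∈ I) (hγ : κ.IsTopGenerator γ)
    (J₁ J₂ : IwasawaH1DataCoeff T p κ γ) :
    Module.Finite (PowerSeries A) J₁.H ↔ Module.Finite (PowerSeries A) J₂.H := by
  obtain ⟨e, -⟩ := exists_linearEquiv_proj_eq hp hγ J₁ J₂
  exact ⟨fun _ ↦ Module.Finite.equiv e, fun _ ↦ Module.Finite.equiv e.symm⟩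

/-- Torsion-freeness over `A⟦X⟧` (Thm. 12.4 (2)) holds for one pin iff for any other (rigidity; an
injective semilinear map pulls back `Module.IsTorsionFree`). [cite: Kato2004Asterisque, Thm. 12.4 (2) (p. 221)] -/
theorem isTorsionFree_iff (hp : (p : A) ∈ I) (hγ : κ.IsTopGenerator γ)
    (J₁ J₂ : IwasawaH1DataCoeff T p κ γ) :
    Module.IsTorsionFree (PowerSeries A) J₁.H ↔ Module.IsTorsionFree (PowerSeries A) J₂.H := by
  obtain ⟨e, -⟩ := exists_linearEquiv_proj_eq hp hγ J₁ J₂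
  exact ⟨fun _ ↦ e.symm.injective.moduleIsTorsionFree _ (map_smul e.symm),
    fun _ ↦ e.injective.moduleIsTorsionFree _ (map_smul e)⟩

/-- The `A⟦X⟧`-rank (Thm. 12.4 (2): rank one) is the same for all pins (rigidity, `LinearEquiv.rank_eq`).
[cite: Kato2004Asterisque, Thm. 12.4 (2) (p. 221)] -/
theorem rank_eq (hp : (p : A) ∈ I) (hγ : κ.IsTopGenerator γ) (J₁ J₂ : IwasawaH1DataCoeff T p κ γ) :
    Module.rank (PowerSeries A) J₁.H = Module.rank (PowerSeries A) J₂.H := by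
  obtain ⟨e, -⟩ := exists_linearEquiv_proj_eq hp hγ J₁ J₂
  exact e.rank_eq

end Rigidity

/-! ## §3 Thm. 12.4 (2) for `𝒪_λ`-lattices: ONE datum suffices -/

section PadicCoeff

open CongruenceSubgroup Literature.NumberTheory.EllipticCurves.ModularForms

variable {p : ℕ} [Fact p.Prime] {S : Set (PadicAlgCl p)} {n : ℕ}
  {ρ : FramedGaloisRep ℚ (padicCoeffIntegers S) n} {κ : ZpExtension ℚ p} {γ : absoluteGaloisGroup ℚ}

/-- **Thm. 12.4 (2) / (12.2.1) for `𝒪_λ`-lattices: ONE datum suffices.**  For `𝒪 = padicCoeffIntegers S`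
with `ℚ_p(S)/ℚ_p` finite (a local ring, `𝔪`-adically complete with `p ∈ 𝔪`:
`isAdicComplete_maximalIdeal_padicCoeffIntegers`, `natCast_mem_maximalIdeal_padicCoeffIntegers`), every
`ρ : Γ_ℚ → GL_n(𝒪)`, `κ` and topological generator `γ`: if SOME pin of `𝐇¹_Γ(T_ρ)` is finitely generated,
torsion free and of rank one over `Λ_𝒪 = 𝒪⟦X⟧`, then EVERY pin is.
[cite: Kato2004Asterisque, Thm. 12.4 (2) (p. 221) and §12.2 (12.2.1) (p. 220)] -/
theorem thm12_4_clauses_of_exists [FiniteDimensional ℚ_[p] (padicCoeffField S)]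
    (hγ : κ.IsTopGenerator γ)
    (h : ∃ J : IwasawaH1DataCoeff ρ.toGaloisRep p κ γ,
      Module.Finite (IwasawaAlgebraO S) J.H ∧ Module.IsTorsionFree (IwasawaAlgebraO S) J.H ∧
        Module.rank (IwasawaAlgebraO S) J.H = 1)
    (J' : IwasawaH1DataCoeff ρ.toGaloisRep p κ γ) :
    Module.Finite (IwasawaAlgebraO S) J'.H ∧ Module.IsTorsionFree (IwasawaAlgebraO S) J'.H ∧
      Module.rank (IwasawaAlgebraO S) J'.H = 1 := by
  haveI : IsLocalRing (padicCoeffIntegers S) := isLocalRing_padicCoeffIntegers _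
  haveI := IwasawaH1CoeffExists.isAdicComplete_maximalIdeal_padicCoeffIntegers p S
  have hp := IwasawaH1CoeffExists.natCast_mem_maximalIdeal_padicCoeffIntegers p S
  obtain ⟨J, hfin, htf, hrk⟩ := h
  exact ⟨(module_finite_iff hp hγ J J').mp hfin, (isTorsionFree_iff hp hγ J J').mp htf,
    (rank_eq hp hγ J J') ▸ hrk⟩

/-- **The named fact `Kato2004.thm12_4_newform` (K0b) follows from its `∃`-form.**  `thm12_4_newform`
quantifies over EVERY datum `I : IwasawaH1DataCoeff ρ.toGaloisRep p κ γ`; by rigidity it suffices to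
produce, under the same binders (verbatim), ONE datum which is finitely generated, torsion free and of rank
one over `Λ_𝒪` — e.g. the norm-compatible families of K0a's construction
(`IwasawaH1CoeffExists.nonempty_iwasawaH1DataCoeff`).  A reduction only: nothing of Thm. 12.4 is proved.
[cite: Kato2004Asterisque, Thm. 12.4 (2) (p. 221) and §12.2 (12.2.1) (p. 220)] -/
theorem thm12_4_newform_of_exists
    (h : ∀ (p : ℕ) [Fact p.Prime] (M : ℕ) [NeZero M] (g : CuspForm (Gamma0 M) 2)
      (ι : coeffField g →+* PadicAlgCl p)
      (ρ : FramedGaloisRep ℚ (padicCoeffIntegers (Set.range ι)) 2)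
      (κ : ZpExtension ℚ p) (γ : absoluteGaloisGroup ℚ),
      IsNewform0 g →
      (∀ v : IsDedekindDomain.HeightOneSpectrum (𝓞 ℚ), ¬ Rat.HeightOneSpectrum.natGenerator v ∣ p * M →
        ρ.IsUnramifiedAt v ∧
          ∃ P : Polynomial (padicCoeffIntegers (Set.range ι)),
            P.map (padicCoeffIntegers (Set.range ι)).subtype =
                Polynomial.X ^ 2
                  - Polynomial.C (embCoeff g ι (Rat.HeightOneSpectrum.natGenerator v)) * Polynomial.X
                  + Polynomial.C ((Rat.HeightOneSpectrum.natGenerator v : ℕ) : PadicAlgCl p) ∧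
              ρ.HasFrobCharpolyAt v P) →
      κ.IsCyclotomic → κ.IsTopGenerator γ →
        ∃ I : IwasawaH1DataCoeff ρ.toGaloisRep p κ γ,
          Module.Finite (IwasawaAlgebraO (Set.range ι)) I.H ∧
            Module.IsTorsionFree (IwasawaAlgebraO (Set.range ι)) I.H ∧
              Module.rank (IwasawaAlgebraO (Set.range ι)) I.H = 1) :
    thm12_4_newform := by
  intro p _ M _ g ι ρ κ γ hg hρ hκ hγ I
  haveI : FiniteDimensional ℚ (coeffField g) :=
    IsNewform0.finiteDimensional_coeffField_holds hg
  haveI : FiniteDimensional ℚ_[p] (padicCoeffField (Set.range ι)) :=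
    GreenbergSelmer.finiteDimensional_padicCoeffField ι
  exact thm12_4_clauses_of_exists hγ (h p M g ι ρ κ γ hg hρ hκ hγ) I

end PadicCoeff

end IwasawaH1DataCoeff

end Literature.NumberTheory.EllipticCurves.Kato2004

end
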